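import Summits.ResolutionOfSingularities.ResolutionOfSingularities.Theorems.WildTwistedToricLU
import Mathlib.RingTheory.Filtration
import HarnessLib

/-!
# WildTwistedToricLU (2/7) — the STRUCTURE THEOREM for rings of invariants of a log-cyclic action

Node «TwistedToricCut» (decomp-res lens-1 g33), tree file 2/7: abstract commutative algebra II.

* `exists_tail` — the Artin–Rees TAIL: for a module-finite extension `A → B` with `A` Noetherian and an
  ideal `J` of `B` some power of which lies in `𝔪_A B`, every element of `A` that is `J`-adically deep enough
  lies in `𝔪_A²` (Mathlib's Artin–Rees lemma `Ideal.exists_pow_inf_eq_pow_smul` for the submodule `A·1 ⊆ B`).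
* `maximalIdeal_eq_span_twMono` — THE STRUCTURE THEOREM: for a regular local domain `B` with r.s.p. `x`,
  a ring endomorphism `σ` acting by `σ xⱼ = xⱼ u^{Nⱼ}`, `u = 1 + η`, with `σ − 1 ≡ 0 (mod η𝔪)`, a unit `Φ ≡ 1`
  with `σ Φ = Φ u^p`, `p = 0` in `B`, and a local Noetherian subring `A → B` of invariants (dominated, with
  all residues, `B` module-finite over `A`), the maximal ideal of `A` is generated by the twisted monomials
  `z_β = x^β Φ^{−⟨β,N⟩/p}`, `β ∈ ℕ^d ∖ 0`, `p ∣ ⟨β,N⟩`.  Proof: PEEL (file 1) to all orders, the TAIL at order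
  `(d(p−1)+1)·n₀` (every monomial of degree `d(p−1)+1` contains some `xⱼ^p = z_{p eⱼ} Φ^{Nⱼ} ∈ 𝔪_A B`), Nakayama.

(Sources: Matsumura1987 Thm. 17.10, Thm. 8.5 (Artin–Rees), Thm. 2.2 (Nakayama); this node.)
-/

noncomputable section

open IsLocalRing MvPolynomial Literature.AlgebraicGeometry.Resolution

universe u v

namespace Summit.ResolutionOfSingularities.ResolutionOfSingularities.Theorems.WildTwistedToricLU

section Tail

variable {A : Type u} {B : Type v} [CommRing A] [CommRing B] [Algebra A B]

/-- THE ARTIN–REES TAIL.  `A → B` injective and module-finite, `A` Noetherian, `I ⊆ A`, `J ⊆ B` ideals with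
`J^c ⊆ I B`: there is `n₀` with `A ∩ J^{n₀} ⊆ I²`. [cite: Matsumura1987, Thm. 8.5 (Artin–Rees)] -/
theorem exists_tail [IsNoetherianRing A] [Module.Finite A B]
    (hinj : Function.Injective (algebraMap A B)) (I : Ideal A) (J : Ideal B) (c : ℕ)
    (hJ : J ^ c ≤ I.map (algebraMap A B)) :
    ∃ n₀ : ℕ, ∀ a : A, algebraMap A B a ∈ J ^ n₀ → a ∈ I ^ 2 := by
  obtain ⟨k, hk⟩ := Ideal.exists_pow_inf_eq_pow_smul I (Submodule.span A {(1 : B)})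
  refine ⟨c * (k + 2), fun a ha => ?_⟩
  have h1 : algebraMap A B a ∈ (I ^ (k + 2)).map (algebraMap A B) := by
    have hle : J ^ (c * (k + 2)) ≤ (I ^ (k + 2)).map (algebraMap A B) := by
      rw [pow_mul, Ideal.map_pow]
      exact Ideal.pow_right_mono hJ _
    exact hle ha
  have h2 : algebraMap A B a ∈ I ^ (k + 2) • (⊤ : Submodule A B) := by
    rw [Ideal.smul_top_eq_map]
    exact h1
  have h3 : algebraMap A B a ∈ Submodule.span A {(1 : B)} := by
    rw [Algebra.algebraMap_eq_smul_one]
    exact Submodule.smul_mem _ _ (Submodule.subset_span rfl)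
  have h5 : algebraMap A B a ∈ I ^ 2 • Submodule.span A {(1 : B)} := by
    have hmem : algebraMap A B a ∈ I ^ (k + 2) • (⊤ : Submodule A B) ⊓ Submodule.span A {(1 : B)} :=
      ⟨h2, h3⟩
    rw [hk (k + 2) (by omega), show k + 2 - k = 2 by omega] at hmem
    exact Submodule.smul_mono le_rfl inf_le_right hmem
  obtain ⟨r, hr, hr1⟩ := (Submodule.mem_smul_span_singleton).mp h5
  rw [Algebra.smul_def, mul_one] at hr1
  rwa [← hinj hr1]

end Tail

section Structure

variable {B : Type v} [CommRing B] {d : ℕ}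

/-- `x^{single j n} = xⱼ^n`. -/
theorem mono_single (x : Fin d → B) (j : Fin d) (n : ℕ) : mono x (Finsupp.single j n) = x j ^ n := by
  rw [mono, Finset.prod_eq_single j (fun i _ hi => by rw [Finsupp.single_eq_of_ne hi, pow_zero])
    (fun h => absurd (Finset.mem_univ j) h), Finsupp.single_eq_same]

/-- `⟨single j n, N⟩ = Nⱼ n`. -/
theorem pair_single (N : Fin d → ℤ) (j : Fin d) (n : ℕ) : pair N (Finsupp.single j n) = N j * n := by
  rw [pair, Finset.sum_eq_single j (fun i _ hi => by
    rw [Finsupp.single_eq_of_ne hi, Nat.cast_zero, mul_zero]) (fun h => absurd (Finset.mem_univ j) h),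
    Finsupp.single_eq_same]

/-- THE FROBENIUS RELATION `xⱼ^p = z_{p eⱼ} · Φ^{Nⱼ}`. -/
theorem pow_eq_twMono_mul (x : Fin d → B) (Φ : Bˣ) (N : Fin d → ℤ) {p : ℕ} (hp : 0 < p) (j : Fin d) :
    x j ^ p = twMono x Φ N p (Finsupp.single j p) * ((Φ ^ N j : Bˣ) : B) := by
  have hp0 : (p : ℤ) ≠ 0 := by exact_mod_cast hp.ne'
  rw [twMono, mono_single, pair_single, Int.mul_ediv_cancel _ hp0, mul_assoc, ← Units.val_mul,
    ← zpow_add, neg_add_cancel, zpow_zero, Units.val_one, mul_one]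

/-- A non-trivial twisted monomial lies in the maximal ideal (when `(x) = 𝔪`). -/
theorem twMono_mem_maximalIdeal [IsLocalRing B] (x : Fin d → B)
    (hx : Ideal.span (Set.range x) = maximalIdeal B) (Φ : Bˣ) (N : Fin d → ℤ) (p : ℕ)
    {β : Fin d →₀ ℕ} (hβ : β ≠ 0) : twMono x Φ N p β ∈ maximalIdeal B := by
  have hdeg : β.degree ≠ 0 := fun h => hβ ((Finsupp.degree_eq_zero_iff β).mp h)
  have h1 : mono x β ∈ maximalIdeal B := by
    rw [← hx]
    exact Ideal.pow_le_self hdeg (mono_mem_pow x β)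
  exact Ideal.mul_mem_right _ _ h1

/-- Pigeonhole: an exponent vector of degree `d(p−1)+1` has an entry `≥ p`. -/
theorem exists_le_of_degree_eq {p : ℕ} {β : Fin d →₀ ℕ} (hβ : β.degree = d * (p - 1) + 1) :
    ∃ j, p ≤ β j := by
  by_contra h
  have hle : β.degree ≤ d * (p - 1) := by
    rw [Finsupp.degree_eq_sum]
    calc ∑ i, β i ≤ ∑ _i : Fin d, (p - 1) := Finset.sum_le_sum fun i _ => by
            have := not_exists.mp h i; omega
      _ = d * (p - 1) := by rw [Finset.sum_const, Finset.card_univ, Fintype.card_fin, smul_eq_mul]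
  omega

variable {A : Type u} [CommRing A] [Algebra A B]

set_option maxHeartbeats 800000 in
/-- **THE STRUCTURE THEOREM for the ring of invariants of a log-cyclic action** (node «TwistedToricCut»).
`B` a regular local domain with r.s.p. `x = (x₁,…,x_d)`, `σ : B → B` a ring endomorphism with
`σ xⱼ = xⱼ u^{Nⱼ}`, `u = 1 + η`, `η ∈ 𝔪 ∖ 0`, `σ b − b ∈ η𝔪` for all `b`, `p` prime with `p = 0` in `B`, `Φ ≡ 1`
a unit with `σ Φ = Φ u^p`; `A → B` injective, module-finite, `A` local Noetherian, dominated (`𝔪_A = A ∩ 𝔪_B`),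
consisting of invariants, containing every invariant and representing every residue.  Then
`𝔪_A = ( z_β : β ∈ ℕ^d ∖ 0, p ∣ ⟨β,N⟩ )`, `z_β = x^β Φ^{−⟨β,N⟩/p}` (as elements of `A`).
Proof: PEEL (`exists_peel`) to all orders; TAIL (`exists_tail`, with `𝔪_B^{d(p−1)+1} ⊆ 𝔪_A B` from
`xⱼ^p = z_{p eⱼ} Φ^{Nⱼ}`); Nakayama. [cite: Matsumura1987, Thm. 17.10, Thm. 8.5, Thm. 2.2; this node] -/
theorem maximalIdeal_eq_span_twMono [IsLocalRing A] [IsNoetherianRing A] [Module.Finite A B]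
    [IsDomain B] [IsRegularLocalRing B]
    (hinj : Function.Injective (algebraMap A B))
    (hdomA : ∀ a : A, a ∈ maximalIdeal A ↔ algebraMap A B a ∈ maximalIdeal B)
    (hd : (maximalIdeal B).spanFinrank = d) (x : Fin d → B)
    (hx : Ideal.span (Set.range x) = maximalIdeal B) (σ : B →+* B) (u Φ : Bˣ) (N : Fin d → ℤ)
    {p : ℕ} (hp : p.Prime) (hpB : (p : B) = 0) (η : B) (hu : (u : B) = 1 + η)
    (hη : η ∈ maximalIdeal B) (hη0 : η ≠ 0) (hΦ1 : (Φ : B) - 1 ∈ maximalIdeal B)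
    (hσx : ∀ j, σ (x j) = x j * ((u ^ N j : Bˣ) : B))
    (hσΦ : σ (Φ : B) = (Φ : B) * ((u ^ (p : ℤ) : Bˣ) : B))
    (hD : ∀ b : B, ∃ m ∈ maximalIdeal B, σ b - b = η * m)
    (hAfix : ∀ a : A, σ (algebraMap A B a) = algebraMap A B a)
    (hfix : ∀ b : B, σ b = b → ∃ a : A, algebraMap A B a = b)
    (hres : ∀ b : B, ∃ a : A, b - algebraMap A B a ∈ maximalIdeal B) :
    maximalIdeal A = Ideal.span {a : A | ∃ β : Fin d →₀ ℕ, β ≠ 0 ∧ (p : ℤ) ∣ pair N β ∧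
      algebraMap A B a = twMono x Φ N p β} := by
  classical
  set φ := algebraMap A B with hφ
  set G : Set A := {a : A | ∃ β : Fin d →₀ ℕ, β ≠ 0 ∧ (p : ℤ) ∣ pair N β ∧ φ a = twMono x Φ N p β}
    with hG
  set J : Ideal A := Ideal.span G with hJ
  have hp0 : 0 < p := hp.pos
  -- `J ≤ 𝔪_A`
  have hJle : J ≤ maximalIdeal A := by
    refine Ideal.span_le.mpr ?_
    rintro a ⟨β, hβ0, -, ha⟩
    exact (hdomA a).mpr (ha ▸ twMono_mem_maximalIdeal x hx Φ N p hβ0)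
  -- every invariant twisted monomial comes from `G`
  have hzG : ∀ β : Fin d →₀ ℕ, β ≠ 0 → (p : ℤ) ∣ pair N β → ∃ g ∈ G, φ g = twMono x Φ N p β := by
    intro β hβ0 hdiv
    obtain ⟨g, hg⟩ := hfix _ (apply_twMono x σ u Φ N p hσx hσΦ hdiv)
    exact ⟨g, ⟨β, hβ0, hdiv, hg⟩, hg⟩
  -- `𝔪_B^{d(p-1)+1} ⊆ 𝔪_A B`
  have hc : maximalIdeal B ^ (d * (p - 1) + 1) ≤ (maximalIdeal A).map φ := by
    intro b hb
    rw [← hx] at hb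
    obtain ⟨P, hPhom, rfl⟩ := exists_isHomogeneous_of_mem_span_pow x _ hb
    rw [P.as_sum, map_sum]
    refine Ideal.sum_mem _ fun β hβ => ?_
    rw [eval_monomial_eq]
    refine Ideal.mul_mem_left _ _ ?_
    have hdeg : β.degree = d * (p - 1) + 1 := by
      rw [Finsupp.degree_eq_weight_one]; exact hPhom (mem_support_iff.mp hβ)
    obtain ⟨j, hj⟩ := exists_le_of_degree_eq hdeg
    have hsplit : β = (β - Finsupp.single j p) + Finsupp.single j p :=
      (tsub_add_cancel_of_le (Finsupp.single_le_iff.mpr hj)).symm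
    rw [hsplit, mono_add, mono_single, pow_eq_twMono_mul x Φ N hp0 j]
    obtain ⟨g, hgG, hg⟩ := hzG (Finsupp.single j p) (by
      rw [Ne, Finsupp.single_eq_zero]; exact hp.ne_zero) (by rw [pair_single]; exact Dvd.intro_left _ rfl)
    rw [← hg]
    have hgm : φ g ∈ (maximalIdeal A).map φ := Ideal.mem_map_of_mem _ (hJle (Ideal.subset_span hgG))
    exact Ideal.mul_mem_left _ _ (Ideal.mul_mem_right _ _ hgm)
  obtain ⟨n₀, hn₀⟩ := exists_tail hinj (maximalIdeal A) (maximalIdeal B) _ hc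
  -- approximation to all orders by PEEL
  have happrox : ∀ n : ℕ, ∀ a ∈ maximalIdeal A, ∃ j ∈ J, φ (a - j) ∈ maximalIdeal B ^ (n + 1) := by
    intro n
    induction n with
    | zero =>
      intro a ha
      exact ⟨0, J.zero_mem, by rw [sub_zero, zero_add, pow_one]; exact (hdomA a).mp ha⟩
    | succ n ih =>
      intro a ha
      obtain ⟨j, hj, hjn⟩ := ih a ha
      obtain ⟨s, c, hsc, hrest⟩ := exists_peel hd x hx σ u Φ N hp hpB η hu hη hη0 hΦ1 hσx hD
        (Set.range φ) (fun b => by obtain ⟨a', ha'⟩ := hres b; exact ⟨φ a', ⟨a', rfl⟩, ha'⟩)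
        (hAfix (a - j)) hjn
      choose a' ha' using fun β : Fin d →₀ ℕ => fun (hβ : β ∈ s) => (hsc β hβ).2.2
      choose g hgG hg using fun β : Fin d →₀ ℕ => fun (hβ : β ∈ s) =>
        hzG β (fun h0 => by
          have := (hsc β hβ).1
          rw [h0, map_zero] at this
          exact Nat.succ_ne_zero n this.symm) (hsc β hβ).2.1
      set j' : A := ∑ β ∈ s.attach, a' β.1 β.2 * g β.1 β.2 with hj'
      have hj'J : j' ∈ J := Ideal.sum_mem _ fun β _ => Ideal.mul_mem_left _ _ (Ideal.subset_span (hgG β.1 β.2))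
      refine ⟨j + j', J.add_mem hj hj'J, ?_⟩
      have e : φ (a - (j + j')) = φ (a - j) - ∑ β ∈ s, c β * twMono x Φ N p β := by
        rw [← Finset.sum_attach s, sub_add_eq_sub_sub, map_sub φ (a - j), hj', map_sum]
        congr 1
        exact Finset.sum_congr rfl fun β _ => by rw [map_mul, ha' β.1 β.2, hg β.1 β.2]
      rw [e]
      exact hrest
  -- Nakayama
  have hle : maximalIdeal A ≤ J ⊔ maximalIdeal A • maximalIdeal A := by
    intro a ha
    obtain ⟨j, hj, hjn⟩ := happrox n₀ a ha
    have h2 : a - j ∈ maximalIdeal A ^ 2 :=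
      hn₀ (a - j) (Ideal.pow_le_pow_right (Nat.le_succ n₀) hjn)
    rw [show a = j + (a - j) by ring]
    refine Submodule.add_mem_sup (hj) ?_
    rw [Ideal.smul_eq_mul, ← pow_two]
    exact h2
  exact le_antisymm
    (Submodule.le_of_le_smul_of_le_jacobson_bot (IsNoetherian.noetherian _)
      (IsLocalRing.maximalIdeal_le_jacobson _) hle) hJle

end Structure

end Summit.ResolutionOfSingularities.ResolutionOfSingularities.Theorems.WildTwistedToricLU

end
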